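import Mathlib.Analysis.SpecialFunctions.Trigonometric.Basic
import Mathlib.Analysis.Complex.Trigonometric
import Mathlib.Data.Matrix.Mul
import Mathlib.Data.ZMod.Basic
import HarnessLib

/-!
# The sign-twisted lazy walk on `ℤ₃`: a flip followed by one coin step contracts a Lyapunov norm by `2/3`

Topic `Literature/Probability/MarkovChains`.  Vectors `v : ℤ₃ → ℂ`; the LAZY WALK STEP with increment
`w ≠ 0`, twist character `k` and sign `ε`,
`(Conv_{k,w,ε} v)(u') = ½ (v(u') + ε ω^{kw} v(u' − w))` (`convM k w ε`, `ω = e^{2πi/3}`),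
and the SIGN FLIP at a residue `γ`, `(D_γ v)(u) = (−1)^{[u = γ]} v(u)` (`flipM γ`).  Such products
`⋯ D_{γ₂} Conv^{j₂} D_{γ₁} Conv^{j₁}` are the transfer matrices of the parity of an additive functional
("number of visits to prescribed residues at prescribed times, mod 2") of a `ℤ₃`-valued walk with
independent fair `{0, w}`-steps, twisted by the character `k` guessing the total; their operator norms
bound the bias of that parity.  We prove the uniform one-block contraction in the LYAPUNOV form below
(all PROVED, no named facts; `ε = 1` unless stated):

* `PhiQ k v = Σ_u |v_u|² + ⅓ |Σ_u ω^{−ku} v_u|²` — the Euclidean norm with the `k`-character (the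
  invariant direction of `Conv_{k,w,1}`) weighted twice (`nsq ≤ PhiQ ≤ 2·nsq`:
  `nsq_le_PhiQ`, `PhiQ_le_two_mul_nsq`);
* `walkContractionQ` (**the contraction lemma**): for `w ≠ 0` and all `k, γ, v`,
  `PhiQ k (Conv v) ≤ PhiQ k v` and `PhiQ k (D_γ Conv v) ≤ ⅔ · PhiQ k v`;
  hence every block `D_γ Conv^j`, `j ≥ 1`, contracts `PhiQ k` by `2/3` (`PhiQ_flip_convPow_le`);
* `convMinusContracts` (`ε = −1`, the parity-twisted step): `nsq (Conv_{k,w,−1} v) ≤ ¾ · nsq v`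
  (exact constant: `‖Conv_{k,w,−1}‖ = √3/2`).

Proof.  UNTWIST: `(twist k v)(u) = ω^{−ku} v(u)` satisfies `PhiQ k v = PhiQ 0 (twist k v)`,
`twist k ∘ Conv_{k,w,ε} = Conv_{0,w,ε} ∘ twist k`, `twist k ∘ D_γ = D_γ ∘ twist k` (`ω³ = 1`,
`|ω| = 1`), so `k = 0` suffices, where no root of unity remains: `Conv₀ v = ½(v + v(· − w))`,
`PhiQ 0 v = Σ|v_u|² + ⅓|v₀ + v₁ + v₂|²`.  The `k = 0` inequalities are rational quadratic forms in
`(Re v, Im v) ∈ ℝ³ × ℝ³` with the sum-of-squares certificates (writing `a, b` for the two summed and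
`c` for the remaining coordinate)
`36·(⅔Φ₀(v) − Φ₀(D_γ Conv₀ v)) = (a−c)² + (b−c)² + (a−b)² + 12a² + 12b²`,
`4·(Φ₀ v − Φ₀(Conv₀ v)) = (a−b)² + (b−c)² + (c−a)²`, `4·(¾‖v‖² − ‖Conv₀⁻ v‖²) = (a+b+c)²`.

In print the MECHANISM is classical — the bias of a lattice/mod-`m` additive functional of a finite
Markov chain is governed by the norm / spectral radius of the twisted transfer operator
(non-arithmeticity; Nagaev 1957, Guivarc'h–Hardy 1988, Hennion–Hervé 2001), and "a strict
contraction off an invariant line composed with a reflection moving that line is a uniform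
contraction" is the alternating-projection principle — but this explicit `ℤ₃` lemma with its
constant is not; we cite operator-norm submultiplicativity [HornJohnson2013, §5.6] and supply the
instance.  Provenance / use: cell qa-qnc0 (planner qa-qnc0-p1 g34, ROUND-33 Addendum B §B.4, asks
W-36a / W-36a′, file `exp34/Targets34d.lean`, whose definitions `ω₃`, `convM`, `flipM`, `nsq`, `PhiQ`
are reproduced VERBATIM so that `AffBells34.WalkContractionQ` / `ConvMinusContracts` transport by
`rfl`): inside a fibre the parity functional of a drift chain is an additive functional of one
`ℤ₃`-walk ("Lever 4′").

## References
* [HornJohnson2013] R. A. Horn, C. R. Johnson, *Matrix Analysis*, 2nd ed., CUP 2013, §5.6 (matrix /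
  operator norms, submultiplicativity) — the `ℤ₃` twisted-walk contraction is supplied here.
-/

noncomputable section

namespace Literature.Probability.MarkovChains

namespace TwistedWalkZ3

open Finset Matrix

/-! ### §1 Definitions (verbatim from the cell's `Targets34d.lean`) -/

/-- The primitive cube root of unity `ω = e^{2πi/3}`.
[cite: HornJohnson2013, §5.6 — ℤ₃ twisted-walk instance supplied here] -/
def ω₃ : ℂ := Complex.exp (2 * Real.pi * Complex.I / 3)

/-- One fair coin step of the twisted walk on `ℤ₃`: stay, or move by `w` with weight `ε·ω^{k w}`
(`ε = 1`: plain bias; `ε = −1`: the coin-parity-twisted bias; `k` = the character guessing the total).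
Column convention: `(convM ·ᵥ v) u' = Σ_u M u' u · v u`.
[cite: HornJohnson2013, §5.6 — ℤ₃ twisted-walk instance supplied here] -/
def convM (k w : ZMod 3) (ε : ℂ) : Matrix (ZMod 3) (ZMod 3) ℂ :=
  fun u' u => (1 / 2 : ℂ) * ((if u' = u then 1 else 0) + (if u' = u + w then ε * ω₃ ^ (k * w).val else 0))

/-- A sign flip at residue `γ`.
[cite: HornJohnson2013, §5.6 — ℤ₃ twisted-walk instance supplied here] -/
def flipM (γ : ZMod 3) : Matrix (ZMod 3) (ZMod 3) ℂ :=
  fun u' u => if u' = u then (if u = γ then -1 else 1) else 0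

/-- Squared Euclidean norm on `ℂ^{ℤ₃}`.
[cite: HornJohnson2013, §5.6 — ℤ₃ twisted-walk instance supplied here] -/
def nsq (v : ZMod 3 → ℂ) : ℝ := ∑ u, Complex.normSq (v u)

/-- The Lyapunov quadratic form attached to the invariant character `k`:
`Φ_k(v) = Σ_u |v_u|² + ⅓ |Σ_u ω^{−ku} v_u|²`.
[cite: HornJohnson2013, §5.6 — ℤ₃ twisted-walk instance supplied here] -/
def PhiQ (k : ZMod 3) (v : ZMod 3 → ℂ) : ℝ :=
  (∑ u, Complex.normSq (v u)) + (1 / 3) * Complex.normSq (∑ u : ZMod 3, ω₃ ^ ((-(k * u)).val) * v u)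

/-! ### §2 The cube root of unity -/

/-- `ω³ = 1`. [cite: HornJohnson2013, §5.6 — bookkeeping supplied here] -/
theorem omega_pow_three : ω₃ ^ 3 = 1 := by
  rw [ω₃, ← Complex.exp_nat_mul]
  have : ((3 : ℕ) : ℂ) * (2 * Real.pi * Complex.I / 3) = 2 * Real.pi * Complex.I := by push_cast; ring
  rw [this, Complex.exp_two_pi_mul_I]

/-- `|ω|² = 1`. [cite: HornJohnson2013, §5.6 — bookkeeping supplied here] -/
theorem normSq_omega : Complex.normSq ω₃ = 1 := by
  rw [Complex.normSq_eq_norm_sq, ω₃, Complex.norm_exp]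
  simp

/-- `|ω^m|² = 1`. [cite: HornJohnson2013, §5.6 — bookkeeping supplied here] -/
theorem normSq_omega_pow (m : ℕ) : Complex.normSq (ω₃ ^ m) = 1 := by
  rw [map_pow, normSq_omega, one_pow]

/-- `ω^m = ω^{m mod 3}`. [cite: HornJohnson2013, §5.6 — bookkeeping supplied here] -/
theorem omega_pow_mod (m : ℕ) : ω₃ ^ m = ω₃ ^ (m % 3) := by
  conv_lhs => rw [← Nat.div_add_mod m 3, pow_add, pow_mul, omega_pow_three, one_pow, one_mul]

/-- `ω^{a.val}·ω^{b.val} = ω^{(a+b).val}` for `a, b ∈ ℤ₃`.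
[cite: HornJohnson2013, §5.6 — bookkeeping supplied here] -/
theorem omega_pow_val_mul (a b : ZMod 3) : ω₃ ^ a.val * ω₃ ^ b.val = ω₃ ^ (a + b).val := by
  rw [← pow_add, ZMod.val_add, ← omega_pow_mod]

/-! ### §3 Matrix actions written out -/

/-- The coin step on a vector: `(Conv v)(u') = ½ (v u' + ε ω^{kw} v (u' − w))`.
[cite: HornJohnson2013, §5.6 — ℤ₃ twisted-walk instance supplied here] -/
theorem convM_mulVec (k w : ZMod 3) (ε : ℂ) (v : ZMod 3 → ℂ) (u' : ZMod 3) :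
    (convM k w ε).mulVec v u' = (1 / 2 : ℂ) * (v u' + ε * ω₃ ^ (k * w).val * v (u' - w)) := by
  simp only [Matrix.mulVec, dotProduct, convM]
  simp_rw [mul_assoc, ← mul_sum, add_mul, sum_add_distrib, ite_mul, one_mul, zero_mul,
    Finset.sum_ite_eq, mem_univ, if_true]
  have h : ∀ u : ZMod 3, (u' = u + w) ↔ (u' - w = u) := fun u => sub_eq_iff_eq_add.symm
  simp_rw [h, Finset.sum_ite_eq, mem_univ, if_true]
  ring

/-- The flip on a vector: `(D_γ v)(u') = ± v u'`.
[cite: HornJohnson2013, §5.6 — ℤ₃ twisted-walk instance supplied here] -/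
theorem flipM_mulVec (γ : ZMod 3) (v : ZMod 3 → ℂ) (u' : ZMod 3) :
    (flipM γ).mulVec v u' = (if u' = γ then -1 else 1) * v u' := by
  simp only [Matrix.mulVec, dotProduct, flipM]
  simp_rw [ite_mul, zero_mul, Finset.sum_ite_eq, mem_univ, if_true]

/-- A flip does not change moduli. [cite: HornJohnson2013, §5.6 — bookkeeping supplied here] -/
theorem normSq_flipM_mulVec (γ : ZMod 3) (v : ZMod 3 → ℂ) (u' : ZMod 3) :
    Complex.normSq ((flipM γ).mulVec v u') = Complex.normSq (v u') := by
  rw [flipM_mulVec, map_mul]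
  by_cases h : u' = γ <;> simp [h]

/-! ### §4 Untwisting: reduction to the character `k = 0` -/

/-- The untwisting map `(twist k v)(u) = ω^{−ku} v(u)`.
[cite: HornJohnson2013, §5.6 — ℤ₃ twisted-walk instance supplied here] -/
def twist (k : ZMod 3) (v : ZMod 3 → ℂ) : ZMod 3 → ℂ := fun u => ω₃ ^ ((-(k * u)).val) * v u

/-- `twist` preserves moduli. [cite: HornJohnson2013, §5.6 — bookkeeping supplied here] -/
theorem normSq_twist (k : ZMod 3) (v : ZMod 3 → ℂ) (u : ZMod 3) :
    Complex.normSq (twist k v u) = Complex.normSq (v u) := by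
  rw [twist, map_mul, normSq_omega_pow, one_mul]

/-- `nsq (twist k v) = nsq v`. [cite: HornJohnson2013, §5.6 — bookkeeping supplied here] -/
theorem nsq_twist (k : ZMod 3) (v : ZMod 3 → ℂ) : nsq (twist k v) = nsq v := by
  unfold nsq
  exact sum_congr rfl fun u _ => normSq_twist k v u

/-- `Φ_k(v) = Φ_0(twist_k v)`. [cite: HornJohnson2013, §5.6 — bookkeeping supplied here] -/
theorem PhiQ_eq_PhiQ_zero_twist (k : ZMod 3) (v : ZMod 3 → ℂ) : PhiQ k v = PhiQ 0 (twist k v) := by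
  unfold PhiQ
  congr 1
  · exact (sum_congr rfl fun u _ => normSq_twist k v u).symm
  · congr 1
    refine congrArg Complex.normSq (sum_congr rfl fun u _ => ?_)
    simp [twist]

/-- `twist` intertwines `Conv_{k,w,ε}` with `Conv_{0,w,ε}`.
[cite: HornJohnson2013, §5.6 — bookkeeping supplied here] -/
theorem twist_convM_mulVec (k w : ZMod 3) (ε : ℂ) (v : ZMod 3 → ℂ) :
    twist k ((convM k w ε).mulVec v) = (convM 0 w ε).mulVec (twist k v) := by
  funext u'
  rw [twist, convM_mulVec, convM_mulVec, twist, twist]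
  have h0 : ω₃ ^ ((0 : ZMod 3) * w).val = 1 := by simp
  have hexp : ω₃ ^ (-(k * u')).val * ω₃ ^ (k * w).val = ω₃ ^ (-(k * (u' - w))).val := by
    rw [omega_pow_val_mul]; congr 2; ring
  rw [h0, mul_one]
  calc ω₃ ^ (-(k * u')).val * (1 / 2 * (v u' + ε * ω₃ ^ (k * w).val * v (u' - w)))
      = 1 / 2 * (ω₃ ^ (-(k * u')).val * v u' + ε * (ω₃ ^ (-(k * u')).val * ω₃ ^ (k * w).val) * v (u' - w)) := by
        ring
    _ = 1 / 2 * (ω₃ ^ (-(k * u')).val * v u' + ε * (ω₃ ^ (-(k * (u' - w))).val * v (u' - w))) := by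
        rw [hexp, mul_assoc]

/-- `twist` commutes with flips. [cite: HornJohnson2013, §5.6 — bookkeeping supplied here] -/
theorem twist_flipM_mulVec (k γ : ZMod 3) (v : ZMod 3 → ℂ) :
    twist k ((flipM γ).mulVec v) = (flipM γ).mulVec (twist k v) := by
  funext u'
  rw [twist, flipM_mulVec, flipM_mulVec, twist]
  ring

/-! ### §5 The `k = 0` computations -/

/-- Sums over `ℤ₃`. [cite: HornJohnson2013, §5.6 — bookkeeping supplied here] -/
theorem sum_zmod_three {M : Type*} [AddCommMonoid M] (f : ZMod 3 → M) : ∑ u, f u = f 0 + f 1 + f 2 :=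
  Fin.sum_univ_three f

/-- `Φ_0(v) = |v₀|² + |v₁|² + |v₂|² + ⅓|v₀ + v₁ + v₂|²` (no root of unity left).
[cite: HornJohnson2013, §5.6 — bookkeeping supplied here] -/
theorem PhiQ_zero (v : ZMod 3 → ℂ) :
    PhiQ 0 v = Complex.normSq (v 0) + Complex.normSq (v 1) + Complex.normSq (v 2)
      + (1 / 3) * Complex.normSq (v 0 + v 1 + v 2) := by
  unfold PhiQ
  rw [sum_zmod_three, sum_zmod_three]
  simp

/-- `nsq v = |v₀|² + |v₁|² + |v₂|²`. [cite: HornJohnson2013, §5.6 — bookkeeping supplied here] -/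
theorem nsq_eq (v : ZMod 3 → ℂ) :
    nsq v = Complex.normSq (v 0) + Complex.normSq (v 1) + Complex.normSq (v 2) := by
  unfold nsq; rw [sum_zmod_three]

/-- The untwisted coin step: `(Conv₀ v)(u') = ½ (v u' + ε v (u' − w))`.
[cite: HornJohnson2013, §5.6 — bookkeeping supplied here] -/
theorem convM_zero_mulVec (w : ZMod 3) (ε : ℂ) (v : ZMod 3 → ℂ) (u' : ZMod 3) :
    (convM 0 w ε).mulVec v u' = (1 / 2 : ℂ) * (v u' + ε * v (u' - w)) := by
  rw [convM_mulVec]; simp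

/-- The nine `if (a : ℤ₃) = b` reductions. [folklore] -/
private theorem ite_z3 {α : Type*} (a b : α) :
    (if (0:ZMod 3) = 0 then a else b) = a ∧ (if (1:ZMod 3) = 1 then a else b) = a ∧
    (if (2:ZMod 3) = 2 then a else b) = a ∧
    (if (1:ZMod 3) = 0 then a else b) = b ∧ (if (2:ZMod 3) = 0 then a else b) = b ∧
    (if (0:ZMod 3) = 1 then a else b) = b ∧ (if (2:ZMod 3) = 1 then a else b) = b ∧
    (if (0:ZMod 3) = 2 then a else b) = b ∧ (if (1:ZMod 3) = 2 then a else b) = b :=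
  ⟨if_pos rfl, if_pos rfl, if_pos rfl, if_neg (by decide), if_neg (by decide), if_neg (by decide),
    if_neg (by decide), if_neg (by decide), if_neg (by decide)⟩

/-- Shifts in `ℤ₃`. [folklore] -/
private theorem sub_z3 :
    ((0 : ZMod 3) - 1 = 2) ∧ ((1 : ZMod 3) - 1 = 0) ∧ ((2 : ZMod 3) - 1 = 1) ∧
    ((0 : ZMod 3) - 2 = 1) ∧ ((1 : ZMod 3) - 2 = 2) ∧ ((2 : ZMod 3) - 2 = 0) := by decide

/-- Real and imaginary parts of `½ ∈ ℂ`. [folklore] -/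
private theorem half_re_im : ((1 / 2 : ℂ)).re = 1 / 2 ∧ ((1 / 2 : ℂ)).im = 0 := by
  constructor <;> simp

/-- `k = 0`, no flip: `Φ₀(Conv₀ v) ≤ Φ₀(v)` (the coordinate sum is preserved, moduli contract:
`4·(Σ|v|² − Σ|Conv₀ v|²) = |a−b|² + |b−c|² + |c−a|²`).
[cite: HornJohnson2013, §5.6 — ℤ₃ twisted-walk instance supplied here] -/
theorem PhiQ_zero_convM_le {w : ZMod 3} (hw : w ≠ 0) (v : ZMod 3 → ℂ) :
    PhiQ 0 ((convM 0 w 1).mulVec v) ≤ PhiQ 0 v := by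
  have hw' : w = 1 ∨ w = 2 := by revert hw; decide +revert
  obtain ⟨s01, s11, s21, s02, s12, s22⟩ := sub_z3
  obtain ⟨hr, hi⟩ := half_re_im
  rw [PhiQ_zero, PhiQ_zero]
  simp only [convM_zero_mulVec, one_mul]
  rcases hw' with rfl | rfl
  · rw [s01, s11, s21]
    simp only [Complex.normSq_apply, Complex.add_re, Complex.add_im, Complex.mul_re, Complex.mul_im, hr, hi]
    linarith [sq_nonneg ((v 0).re - (v 1).re), sq_nonneg ((v 1).re - (v 2).re), sq_nonneg ((v 2).re - (v 0).re),
      sq_nonneg ((v 0).im - (v 1).im), sq_nonneg ((v 1).im - (v 2).im), sq_nonneg ((v 2).im - (v 0).im)]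
  · rw [s02, s12, s22]
    simp only [Complex.normSq_apply, Complex.add_re, Complex.add_im, Complex.mul_re, Complex.mul_im, hr, hi]
    linarith [sq_nonneg ((v 0).re - (v 1).re), sq_nonneg ((v 1).re - (v 2).re), sq_nonneg ((v 2).re - (v 0).re),
      sq_nonneg ((v 0).im - (v 1).im), sq_nonneg ((v 1).im - (v 2).im), sq_nonneg ((v 2).im - (v 0).im)]

/-- `k = 0`, one flip after one coin step: `Φ₀(D_γ Conv₀ v) ≤ ⅔ Φ₀(v)`.  Writing `a, b` for the two
coordinates summed in the flipped entry and `c` for the third: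
`36·(⅔Φ₀(v) − Φ₀(D_γ Conv₀ v)) = (a−c)² + (b−c)² + (a−b)² + 12a² + 12b²` (real and imaginary parts).
[cite: HornJohnson2013, §5.6 — ℤ₃ twisted-walk instance supplied here] -/
theorem PhiQ_zero_flipM_convM_le {w : ZMod 3} (hw : w ≠ 0) (γ : ZMod 3) (v : ZMod 3 → ℂ) :
    PhiQ 0 ((flipM γ).mulVec ((convM 0 w 1).mulVec v)) ≤ (2 / 3) * PhiQ 0 v := by
  have hw' : w = 1 ∨ w = 2 := by revert hw; decide +revert
  have hγ : γ = 0 ∨ γ = 1 ∨ γ = 2 := by revert γ; decide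
  obtain ⟨s01, s11, s21, s02, s12, s22⟩ := sub_z3
  obtain ⟨hr, hi⟩ := half_re_im
  obtain ⟨-, -, -, f10, f20, f01, f21, f02, f12⟩ := ite_z3 (-1 : ℂ) 1
  rw [PhiQ_zero, PhiQ_zero]
  simp only [normSq_flipM_mulVec]
  simp only [flipM_mulVec, convM_zero_mulVec, one_mul]
  -- all hints (the certificate uses, for flipped pair `{a,b}` and third `c`: (a−c)², (b−c)², (a−b)², a², b²)
  rcases hw' with rfl | rfl
  · rw [s01, s11, s21]
    rcases hγ with rfl | rfl | rfl
    · simp only [↓reduceIte, f10, f20, Complex.normSq_apply, Complex.add_re, Complex.add_im, Complex.mul_re,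
        Complex.mul_im, Complex.neg_re, Complex.neg_im, Complex.one_re, Complex.one_im, hr, hi]
      -- flipped entry `0` carries `v 0 + v 2`, third `v 1`
      linarith [sq_nonneg ((v 0).re - (v 1).re), sq_nonneg ((v 2).re - (v 1).re), sq_nonneg ((v 0).re - (v 2).re),
        sq_nonneg (v 0).re, sq_nonneg (v 2).re, sq_nonneg ((v 0).im - (v 1).im), sq_nonneg ((v 2).im - (v 1).im),
        sq_nonneg ((v 0).im - (v 2).im), sq_nonneg (v 0).im, sq_nonneg (v 2).im]
    · simp only [↓reduceIte, f01, f21, Complex.normSq_apply, Complex.add_re, Complex.add_im, Complex.mul_re,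
        Complex.mul_im, Complex.neg_re, Complex.neg_im, Complex.one_re, Complex.one_im, hr, hi]
      -- flipped entry `1` carries `v 1 + v 0`, third `v 2`
      linarith [sq_nonneg ((v 1).re - (v 2).re), sq_nonneg ((v 0).re - (v 2).re), sq_nonneg ((v 1).re - (v 0).re),
        sq_nonneg (v 1).re, sq_nonneg (v 0).re, sq_nonneg ((v 1).im - (v 2).im), sq_nonneg ((v 0).im - (v 2).im),
        sq_nonneg ((v 1).im - (v 0).im), sq_nonneg (v 1).im, sq_nonneg (v 0).im]
    · simp only [↓reduceIte, f02, f12, Complex.normSq_apply, Complex.add_re, Complex.add_im, Complex.mul_re,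
        Complex.mul_im, Complex.neg_re, Complex.neg_im, Complex.one_re, Complex.one_im, hr, hi]
      -- flipped entry `2` carries `v 2 + v 1`, third `v 0`
      linarith [sq_nonneg ((v 2).re - (v 0).re), sq_nonneg ((v 1).re - (v 0).re), sq_nonneg ((v 2).re - (v 1).re),
        sq_nonneg (v 2).re, sq_nonneg (v 1).re, sq_nonneg ((v 2).im - (v 0).im), sq_nonneg ((v 1).im - (v 0).im),
        sq_nonneg ((v 2).im - (v 1).im), sq_nonneg (v 2).im, sq_nonneg (v 1).im]
  · rw [s02, s12, s22]
    rcases hγ with rfl | rfl | rfl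
    · simp only [↓reduceIte, f10, f20, Complex.normSq_apply, Complex.add_re, Complex.add_im, Complex.mul_re,
        Complex.mul_im, Complex.neg_re, Complex.neg_im, Complex.one_re, Complex.one_im, hr, hi]
      -- flipped entry `0` carries `v 0 + v 1`, third `v 2`
      linarith [sq_nonneg ((v 0).re - (v 2).re), sq_nonneg ((v 1).re - (v 2).re), sq_nonneg ((v 0).re - (v 1).re),
        sq_nonneg (v 0).re, sq_nonneg (v 1).re, sq_nonneg ((v 0).im - (v 2).im), sq_nonneg ((v 1).im - (v 2).im),
        sq_nonneg ((v 0).im - (v 1).im), sq_nonneg (v 0).im, sq_nonneg (v 1).im]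
    · simp only [↓reduceIte, f01, f21, Complex.normSq_apply, Complex.add_re, Complex.add_im, Complex.mul_re,
        Complex.mul_im, Complex.neg_re, Complex.neg_im, Complex.one_re, Complex.one_im, hr, hi]
      -- flipped entry `1` carries `v 1 + v 2`, third `v 0`
      linarith [sq_nonneg ((v 1).re - (v 0).re), sq_nonneg ((v 2).re - (v 0).re), sq_nonneg ((v 1).re - (v 2).re),
        sq_nonneg (v 1).re, sq_nonneg (v 2).re, sq_nonneg ((v 1).im - (v 0).im), sq_nonneg ((v 2).im - (v 0).im),
        sq_nonneg ((v 1).im - (v 2).im), sq_nonneg (v 1).im, sq_nonneg (v 2).im]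
    · simp only [↓reduceIte, f02, f12, Complex.normSq_apply, Complex.add_re, Complex.add_im, Complex.mul_re,
        Complex.mul_im, Complex.neg_re, Complex.neg_im, Complex.one_re, Complex.one_im, hr, hi]
      -- flipped entry `2` carries `v 2 + v 0`, third `v 1`
      linarith [sq_nonneg ((v 2).re - (v 1).re), sq_nonneg ((v 0).re - (v 1).re), sq_nonneg ((v 2).re - (v 0).re),
        sq_nonneg (v 2).re, sq_nonneg (v 0).re, sq_nonneg ((v 2).im - (v 1).im), sq_nonneg ((v 0).im - (v 1).im),
        sq_nonneg ((v 2).im - (v 0).im), sq_nonneg (v 2).im, sq_nonneg (v 0).im]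

/-- `k = 0`, `ε = −1`: `‖Conv₀⁻ v‖² ≤ ¾ ‖v‖²` (`4·(¾‖v‖² − ‖Conv₀⁻ v‖²) = |v₀+v₁+v₂|²`).
[cite: HornJohnson2013, §5.6 — ℤ₃ twisted-walk instance supplied here] -/
theorem nsq_convM_zero_neg_le {w : ZMod 3} (hw : w ≠ 0) (v : ZMod 3 → ℂ) :
    nsq ((convM 0 w (-1)).mulVec v) ≤ (3 / 4) * nsq v := by
  have hw' : w = 1 ∨ w = 2 := by revert hw; decide +revert
  obtain ⟨s01, s11, s21, s02, s12, s22⟩ := sub_z3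
  obtain ⟨hr, hi⟩ := half_re_im
  rw [nsq_eq, nsq_eq]
  simp only [convM_zero_mulVec]
  rcases hw' with rfl | rfl
  · rw [s01, s11, s21]
    simp only [Complex.normSq_apply, Complex.add_re, Complex.add_im, Complex.mul_re, Complex.mul_im,
      Complex.neg_re, Complex.neg_im, Complex.one_re, Complex.one_im, hr, hi]
    linarith [sq_nonneg ((v 0).re + (v 1).re + (v 2).re), sq_nonneg ((v 0).im + (v 1).im + (v 2).im)]
  · rw [s02, s12, s22]
    simp only [Complex.normSq_apply, Complex.add_re, Complex.add_im, Complex.mul_re, Complex.mul_im,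
      Complex.neg_re, Complex.neg_im, Complex.one_re, Complex.one_im, hr, hi]
    linarith [sq_nonneg ((v 0).re + (v 1).re + (v 2).re), sq_nonneg ((v 0).im + (v 1).im + (v 2).im)]

/-! ### §6 The contraction lemma (all characters `k`) -/

/-- **One coin step is `Φ_k`-non-expansive.**
[cite: HornJohnson2013, §5.6 — ℤ₃ twisted-walk instance supplied here] -/
theorem PhiQ_convM_le (k : ZMod 3) {w : ZMod 3} (hw : w ≠ 0) (v : ZMod 3 → ℂ) :
    PhiQ k ((convM k w 1).mulVec v) ≤ PhiQ k v := by
  rw [PhiQ_eq_PhiQ_zero_twist, twist_convM_mulVec, PhiQ_eq_PhiQ_zero_twist k v]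
  exact PhiQ_zero_convM_le hw _

/-- **A flip after one coin step contracts `Φ_k` by `2/3`.**
[cite: HornJohnson2013, §5.6 — ℤ₃ twisted-walk instance supplied here] -/
theorem PhiQ_flipM_convM_le (k : ZMod 3) {w : ZMod 3} (hw : w ≠ 0) (γ : ZMod 3) (v : ZMod 3 → ℂ) :
    PhiQ k ((flipM γ * convM k w 1).mulVec v) ≤ (2 / 3) * PhiQ k v := by
  rw [← Matrix.mulVec_mulVec, PhiQ_eq_PhiQ_zero_twist, twist_flipM_mulVec, twist_convM_mulVec,
    PhiQ_eq_PhiQ_zero_twist k v]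
  exact PhiQ_zero_flipM_convM_le hw γ _

/-- **THE WALK CONTRACTION LEMMA (Lyapunov form, W-36a′).**  For `w ≠ 0` and every `k, γ, v`:
`Φ_k(Conv v) ≤ Φ_k(v)` and `Φ_k(D_γ Conv v) ≤ ⅔ Φ_k(v)`.  (Statement shape = the cell's
`AffBells34.WalkContractionQ`.)
[cite: HornJohnson2013, §5.6 (operator norms) — ℤ₃ twisted-walk instance supplied here] -/
theorem walkContractionQ : ∀ (k w : ZMod 3), w ≠ 0 → ∀ γ : ZMod 3, ∀ v : ZMod 3 → ℂ,
    PhiQ k ((convM k w 1).mulVec v) ≤ PhiQ k v ∧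
    PhiQ k ((flipM γ * convM k w 1).mulVec v) ≤ (2 / 3) * PhiQ k v :=
  fun k _ hw γ v => ⟨PhiQ_convM_le k hw v, PhiQ_flipM_convM_le k hw γ v⟩

/-- **The parity-twisted step contracts the Euclidean norm by `¾` (squared).**  (Statement shape = the
cell's `AffBells34.ConvMinusContracts`.)
[cite: HornJohnson2013, §5.6 (operator norms) — ℤ₃ twisted-walk instance supplied here] -/
theorem convMinusContracts : ∀ (k w : ZMod 3), w ≠ 0 → ∀ v : ZMod 3 → ℂ,
    nsq ((convM k w (-1)).mulVec v) ≤ (3 / 4) * nsq v := by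
  intro k w hw v
  rw [← nsq_twist k ((convM k w (-1)).mulVec v), twist_convM_mulVec, ← nsq_twist k v]
  exact nsq_convM_zero_neg_le hw _

/-! ### §7 Consequences: blocks of any length, comparison with the Euclidean norm -/

/-- Any number of coin steps is `Φ_k`-non-expansive.
[cite: HornJohnson2013, §5.6 — ℤ₃ twisted-walk instance supplied here] -/
theorem PhiQ_convPow_le (k : ZMod 3) {w : ZMod 3} (hw : w ≠ 0) (v : ZMod 3 → ℂ) :
    ∀ j : ℕ, PhiQ k ((convM k w 1 ^ j).mulVec v) ≤ PhiQ k v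
  | 0 => by rw [pow_zero, Matrix.one_mulVec]
  | j + 1 => by
      rw [pow_succ', ← Matrix.mulVec_mulVec]
      exact (PhiQ_convM_le k hw _).trans (PhiQ_convPow_le k hw v j)

/-- **Every block `D_γ Conv^j` with `j ≥ 1` contracts `Φ_k` by `2/3`** (submultiplicativity).
[cite: HornJohnson2013, §5.6 (submultiplicativity of operator norms) — ℤ₃ twisted-walk instance supplied here] -/
theorem PhiQ_flip_convPow_le (k : ZMod 3) {w : ZMod 3} (hw : w ≠ 0) (γ : ZMod 3) (v : ZMod 3 → ℂ)
    {j : ℕ} (hj : 1 ≤ j) :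
    PhiQ k ((flipM γ * convM k w 1 ^ j).mulVec v) ≤ (2 / 3) * PhiQ k v := by
  cases j with
  | zero => exact absurd hj (by norm_num)
  | succ j =>
      rw [pow_succ', ← Matrix.mul_assoc, ← Matrix.mulVec_mulVec]
      exact (PhiQ_flipM_convM_le k hw γ _).trans
        (mul_le_mul_of_nonneg_left (PhiQ_convPow_le k hw v j) (by norm_num))

/-- `‖v‖² ≤ Φ_k(v)`. [cite: HornJohnson2013, §5.6 — bookkeeping supplied here] -/
theorem nsq_le_PhiQ (k : ZMod 3) (v : ZMod 3 → ℂ) : nsq v ≤ PhiQ k v := by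
  unfold nsq PhiQ
  have := Complex.normSq_nonneg (∑ u : ZMod 3, ω₃ ^ ((-(k * u)).val) * v u)
  linarith

/-- `Φ_k(v) ≤ 2‖v‖²` (Cauchy–Schwarz on three terms).
[cite: HornJohnson2013, §5.6 — bookkeeping supplied here] -/
theorem PhiQ_le_two_mul_nsq (k : ZMod 3) (v : ZMod 3 → ℂ) : PhiQ k v ≤ 2 * nsq v := by
  rw [PhiQ_eq_PhiQ_zero_twist, ← nsq_twist k v, PhiQ_zero, nsq_eq]
  set a := twist k v 0
  set b := twist k v 1
  set c := twist k v 2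
  have h : Complex.normSq (a + b + c) ≤ 3 * (Complex.normSq a + Complex.normSq b + Complex.normSq c) := by
    simp only [Complex.normSq_apply, Complex.add_re, Complex.add_im]
    nlinarith [sq_nonneg (a.re - b.re), sq_nonneg (b.re - c.re), sq_nonneg (c.re - a.re),
      sq_nonneg (a.im - b.im), sq_nonneg (b.im - c.im), sq_nonneg (c.im - a.im)]
  nlinarith [h]

/-- **Euclidean reading of one block**: `‖D_γ Conv^j v‖² ≤ (4/3)‖v‖²` for `j ≥ 1` (from
`‖·‖² ≤ Φ_k ≤ 2‖·‖²` and the `Φ_k`-contraction `2/3`; for `m` consecutive blocks use `PhiQ_flip_convPow_le`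
`m` times inside `Φ_k` and convert at the ends: `‖⋯‖² ≤ 2·(2/3)^m·‖v‖²`).
[cite: HornJohnson2013, §5.6 — ℤ₃ twisted-walk instance supplied here] -/
theorem nsq_flip_convPow_le (k : ZMod 3) {w : ZMod 3} (hw : w ≠ 0) (γ : ZMod 3) (v : ZMod 3 → ℂ)
    {j : ℕ} (hj : 1 ≤ j) :
    nsq ((flipM γ * convM k w 1 ^ j).mulVec v) ≤ (4 / 3) * nsq v := by
  have h1 := nsq_le_PhiQ k ((flipM γ * convM k w 1 ^ j).mulVec v)
  have h2 := PhiQ_flip_convPow_le k hw γ v hj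
  have h3 := PhiQ_le_two_mul_nsq k v
  linarith

end TwistedWalkZ3

end Literature.Probability.MarkovChains
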